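import Literature.AlgebraicGeometry.Motives.ComplexPointsOpenDense
import Literature.AlgebraicGeometry.Motives.ComplexPointsZariskiDense
import Literature.AlgebraicGeometry.Morphisms.ClosedImmersionFactorOfDense
import HarnessLib

/-!
# Factoring a morphism through an open / closed / locally closed subscheme on COMPLEX points

Topic `AlgebraicGeometry/Motives`; namespace `Literature.AlgebraicGeometry.Motives`.  Theorems only (no definition,
no named fact, no `sorry`).

For a `ℂ`-scheme `X` locally of finite type the complex points `X(ℂ)` are the closed points (Nullstellensatz) and
they are VERY DENSE (`X` is Jacobson): a locally closed subset containing every closed point is everything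
([GortzWedhorn2020] Prop. 3.35).  Hence a morphism `f : X ⟶ Y` whose complex points all land in a subscheme of `Y`
factors through it:

* `range_subset_range_of_forall_pt_mem` — if every complex point of `X` maps into the OPEN image of `j : U ⟶ Y`, then
  `f(X) ⊆ j(U)` (the open `f⁻¹(j(U))` contains all complex points, `isOpen_eq_univ_of_forall_pt_mem`);
* `exists_fac_of_isOpenImmersion_of_forall_pt_mem` / `existsUnique_…` — so `f` factors UNIQUELY through an open
  immersion `j` (Mathlib `IsOpenImmersion.lift`);
* `exists_fac_of_isClosedImmersion_of_forall_pt_mem` / `existsUnique_…` — for `X` moreover reduced and `f`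
  quasi-compact, `f` factors uniquely through a CLOSED immersion `ι : Z ⟶ Y` receiving all complex points (the tree's
  `Morphisms.exists_fac_of_isClosedImmersion_of_dense` on the Zariski-dense set of closed points, `dense_image_pt_of_dense`;
  [Hartshorne1977] II Ex. 3.11 (d), Ex. 4.2);
* `existsUnique_fac_of_locallyClosed_of_forall_pt_mem` — through a LOCALLY CLOSED `U ↪ Z ↪ Y`;
* `existsUnique_fac_of_isOpenImmersion_of_forall_pt_mem_over` (+ `…isClosedImmersion…_over`, `…locallyClosed…_over`) — the same for morphisms of
  `ℂ`-schemes (`SchemeOver ℂ`), the lift being automatically a `ℂ`-morphism.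

Use (cell hodgecm-mathlib, row I-1′, `F1ExtHodgeType` v4 `stub_S2alg`, B-typ03 MEMO §B.2 step (4)): the algebraic map
`X_q ⟶ ℙⁿ` produced by Chow/Arapura from the period map lands, on complex points, in the locally closed Siegel level
`Sg.Mc ↪ P ↪ ℙⁿ`, hence factors through it.  HC_CM is proved only modulo the 7 printed citations until rung 0 closes; this
file proves no cell binder (banked generic leaf, no floor change).

## References
* [GortzWedhorn2020] U. Görtz, T. Wedhorn, *Algebraic Geometry I* (2nd ed. 2020), Prop. 3.35 (very dense closed
  points of Jacobson schemes), §(3.14).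
* [Hartshorne1977] R. Hartshorne, *Algebraic Geometry*, II Ex. 3.11 (d), Ex. 4.2.
-/

noncomputable section

universe u

open CategoryTheory AlgebraicGeometry Topology

namespace Literature.AlgebraicGeometry.Motives

variable {X : SchemeOver ℂ} [LocallyOfFiniteType X.hom]

/-! ### Through an open subscheme -/

/-- **`f(X) ⊆ j(U)` as soon as all complex points of `X` map into the open `j(U)`** (`X` locally of finite type over `ℂ`;
the open `f⁻¹(j(U))` contains every closed point, hence is `X`). [cite: GortzWedhorn2020, Prop. 3.35] -/
theorem range_subset_range_of_forall_pt_mem {U Y : Scheme.{0}} (j : U ⟶ Y) (hj : IsOpen (Set.range j))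
    (f : X.left ⟶ Y) (h : ∀ P : ComplexPoints X, f P.pt ∈ Set.range j) : Set.range f ⊆ Set.range j := by
  have hopen : IsOpen ((fun x : X.left => f x) ⁻¹' Set.range j) := hj.preimage f.continuous
  have huniv := isOpen_eq_univ_of_forall_pt_mem (T := X) hopen (fun P => h P)
  rintro _ ⟨x, rfl⟩
  have hx : x ∈ (fun x : X.left => f x) ⁻¹' Set.range j := by rw [huniv]; trivial
  exact hx

/-- **Factorisation through an open immersion on complex points**: if every complex point of `X` (locally of finite
type over `ℂ`) maps under `f : X ⟶ Y` into the image of the open immersion `j : U ⟶ Y`, then `f = g ≫ j` for some `g`.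
[cite: GortzWedhorn2020, Prop. 3.35] -/
theorem exists_fac_of_isOpenImmersion_of_forall_pt_mem {U Y : Scheme.{0}} (j : U ⟶ Y) [IsOpenImmersion j]
    (f : X.left ⟶ Y) (h : ∀ P : ComplexPoints X, f P.pt ∈ Set.range j) : ∃ g : X.left ⟶ U, g ≫ j = f :=
  ⟨IsOpenImmersion.lift j f (range_subset_range_of_forall_pt_mem j (IsOpenImmersion.isOpen_range j) f h),
    IsOpenImmersion.lift_fac j f _⟩

/-- … and the factorisation is unique (an open immersion is a monomorphism). [cite: GortzWedhorn2020, Prop. 3.35] -/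
theorem existsUnique_fac_of_isOpenImmersion_of_forall_pt_mem {U Y : Scheme.{0}} (j : U ⟶ Y) [IsOpenImmersion j]
    (f : X.left ⟶ Y) (h : ∀ P : ComplexPoints X, f P.pt ∈ Set.range j) : ∃! g : X.left ⟶ U, g ≫ j = f := by
  obtain ⟨g, hg⟩ := exists_fac_of_isOpenImmersion_of_forall_pt_mem j f h
  exact ⟨g, hg, fun g' hg' => (cancel_mono j).1 (hg'.trans hg.symm)⟩

/-! ### Through a closed subscheme (`X` reduced, `f` quasi-compact) -/

/-- **Factorisation through a closed immersion on complex points**: `X` reduced and locally of finite type over `ℂ`,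
`f : X ⟶ Y` quasi-compact, `ι : Z ⟶ Y` a closed immersion receiving every complex point of `X` ⟹ `f = g ≫ ι` for some
`g` (the closed points are Zariski dense; `Morphisms.exists_fac_of_isClosedImmersion_of_dense`).
[cite: Hartshorne1977, II Ex. 3.11 (d) and Ex. 4.2] [cite: GortzWedhorn2020, Prop. 3.35] -/
theorem exists_fac_of_isClosedImmersion_of_forall_pt_mem [IsReduced X.left] {Z Y : Scheme.{0}} (ι : Z ⟶ Y)
    [IsClosedImmersion ι] (f : X.left ⟶ Y) [QuasiCompact f] (h : ∀ P : ComplexPoints X, f P.pt ∈ Set.range ι) :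
    ∃ g : X.left ⟶ Z, g ≫ ι = f := by
  have hdense : Dense (AlgPoints.pt '' (Set.univ : Set (ComplexPoints X)) : Set X.left) :=
    dense_image_pt_of_dense dense_univ
  refine Morphisms.exists_fac_of_isClosedImmersion_of_dense ι f _ hdense ?_
  rintro _ ⟨P, -, rfl⟩
  exact h P

/-- … uniquely. [cite: Hartshorne1977, II Ex. 4.2] -/
theorem existsUnique_fac_of_isClosedImmersion_of_forall_pt_mem [IsReduced X.left] {Z Y : Scheme.{0}} (ι : Z ⟶ Y)
    [IsClosedImmersion ι] (f : X.left ⟶ Y) [QuasiCompact f] (h : ∀ P : ComplexPoints X, f P.pt ∈ Set.range ι) :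
    ∃! g : X.left ⟶ Z, g ≫ ι = f := by
  obtain ⟨g, hg⟩ := exists_fac_of_isClosedImmersion_of_forall_pt_mem ι f h
  exact ⟨g, hg, fun g' hg' => Morphisms.fac_unique ι (hg'.trans hg.symm)⟩

/-! ### Through a locally closed subscheme `U ↪ Z ↪ Y` -/

/-- **Factorisation through a locally closed subscheme on complex points**: `jo : U ⟶ Z` an open immersion, `ι : Z ⟶ Y`
a closed immersion, `X` reduced and locally of finite type over `ℂ`, `f : X ⟶ Y` quasi-compact with every complex point
of `X` mapping into `ι(jo(U))` ⟹ a unique `g : X ⟶ U` with `g ≫ jo ≫ ι = f`.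
[cite: GortzWedhorn2020, Prop. 3.35] [cite: Hartshorne1977, II Ex. 3.11 (d), Ex. 4.2] -/
theorem existsUnique_fac_of_locallyClosed_of_forall_pt_mem [IsReduced X.left] {U Z Y : Scheme.{0}} (jo : U ⟶ Z)
    [IsOpenImmersion jo] (ι : Z ⟶ Y) [IsClosedImmersion ι] (f : X.left ⟶ Y) [QuasiCompact f]
    (h : ∀ P : ComplexPoints X, f P.pt ∈ Set.range (jo ≫ ι)) : ∃! g : X.left ⟶ U, g ≫ jo ≫ ι = f := by
  -- through the closed `Z`
  have hZ : ∀ P : ComplexPoints X, f P.pt ∈ Set.range ι := by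
    intro P
    obtain ⟨u, hu⟩ := h P
    exact ⟨jo u, by rw [← Scheme.Hom.comp_apply]; exact hu⟩
  obtain ⟨g₁, hg₁, -⟩ := existsUnique_fac_of_isClosedImmersion_of_forall_pt_mem ι f hZ
  -- through the open `U ⊆ Z`: the complex points of `X` land in `jo(U)` because `ι` is injective
  have hU : ∀ P : ComplexPoints X, g₁ P.pt ∈ Set.range jo := by
    intro P
    obtain ⟨u, hu⟩ := h P
    refine ⟨u, ι.isClosedEmbedding.injective ?_⟩
    rw [← Scheme.Hom.comp_apply, hu, ← Scheme.Hom.comp_apply, hg₁]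
  obtain ⟨g, hg, huniq⟩ := existsUnique_fac_of_isOpenImmersion_of_forall_pt_mem jo g₁ hU
  refine ⟨g, ?_, fun g' hg' => huniq g' ?_⟩
  · show g ≫ jo ≫ ι = f
    rw [← Category.assoc, hg, hg₁]
  · show g' ≫ jo = g₁
    apply Morphisms.fac_unique ι
    have hg'' : g' ≫ jo ≫ ι = f := hg'
    rw [Category.assoc, hg'', hg₁]

/-! ### The same for `ℂ`-morphisms (`SchemeOver ℂ`) -/

/-- **`ℂ`-morphism version (open)**: for `ℂ`-schemes `X U Y` with `X` locally of finite type, an open `ℂ`-immersion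
`j : U ⟶ Y` and a `ℂ`-morphism `f : X ⟶ Y` with all complex points of `X` landing in `j(U)`, there is a unique
`ℂ`-morphism `g : X ⟶ U` with `g ≫ j = f`. [cite: GortzWedhorn2020, Prop. 3.35] -/
theorem existsUnique_fac_of_isOpenImmersion_of_forall_pt_mem_over {U Y : SchemeOver ℂ} (j : U ⟶ Y)
    [IsOpenImmersion j.left] (f : X ⟶ Y) (h : ∀ P : ComplexPoints X, f.left P.pt ∈ Set.range j.left) :
    ∃! g : X ⟶ U, g ≫ j = f := by
  obtain ⟨g₀, hg₀, huniq⟩ := existsUnique_fac_of_isOpenImmersion_of_forall_pt_mem j.left f.left h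
  have hw : g₀ ≫ U.hom = X.hom := by rw [← Over.w j, ← Category.assoc, hg₀, Over.w f]
  refine ⟨Over.homMk g₀ hw, ?_, fun g' hg' => ?_⟩
  · ext
    exact hg₀
  · have hg'' : g' ≫ j = f := hg'
    ext
    show g'.left = g₀
    exact huniq _ (show g'.left ≫ j.left = f.left by rw [← Over.comp_left, hg''])

/-- **`ℂ`-morphism version (closed)**: `X` reduced, locally of finite type, `f` quasi-compact, `ι` a closed `ℂ`-immersion
receiving all complex points of `X` ⟹ a unique `ℂ`-morphism `g` with `g ≫ ι = f`.
[cite: Hartshorne1977, II Ex. 3.11 (d), Ex. 4.2] [cite: GortzWedhorn2020, Prop. 3.35] -/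
theorem existsUnique_fac_of_isClosedImmersion_of_forall_pt_mem_over [IsReduced X.left] {Z Y : SchemeOver ℂ} (ι : Z ⟶ Y)
    [IsClosedImmersion ι.left] (f : X ⟶ Y) [QuasiCompact f.left]
    (h : ∀ P : ComplexPoints X, f.left P.pt ∈ Set.range ι.left) : ∃! g : X ⟶ Z, g ≫ ι = f := by
  obtain ⟨g₀, hg₀, huniq⟩ := existsUnique_fac_of_isClosedImmersion_of_forall_pt_mem ι.left f.left h
  have hw : g₀ ≫ Z.hom = X.hom := by rw [← Over.w ι, ← Category.assoc, hg₀, Over.w f]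
  refine ⟨Over.homMk g₀ hw, ?_, fun g' hg' => ?_⟩
  · ext
    exact hg₀
  · have hg'' : g' ≫ ι = f := hg'
    ext
    show g'.left = g₀
    exact huniq _ (show g'.left ≫ ι.left = f.left by rw [← Over.comp_left, hg''])

/-- **`ℂ`-morphism version (locally closed `U ↪ Z ↪ Y`)**. [cite: GortzWedhorn2020, Prop. 3.35] [cite: Hartshorne1977, II Ex. 4.2] -/
theorem existsUnique_fac_of_locallyClosed_of_forall_pt_mem_over [IsReduced X.left] {U Z Y : SchemeOver ℂ} (jo : U ⟶ Z)
    [IsOpenImmersion jo.left] (ι : Z ⟶ Y) [IsClosedImmersion ι.left] (f : X ⟶ Y) [QuasiCompact f.left]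
    (h : ∀ P : ComplexPoints X, f.left P.pt ∈ Set.range (jo.left ≫ ι.left)) : ∃! g : X ⟶ U, g ≫ jo ≫ ι = f := by
  obtain ⟨g₀, hg₀, huniq⟩ := existsUnique_fac_of_locallyClosed_of_forall_pt_mem jo.left ι.left f.left h
  have hw : g₀ ≫ U.hom = X.hom := by
    rw [← Over.w jo, ← Over.w ι, ← Over.w f, ← hg₀]
    simp only [Category.assoc]
  refine ⟨Over.homMk g₀ hw, ?_, fun g' hg' => ?_⟩
  · ext
    show g₀ ≫ jo.left ≫ ι.left = f.left
    exact hg₀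
  · have hg'' : g' ≫ jo ≫ ι = f := hg'
    ext
    show g'.left = g₀
    refine huniq _ ?_
    show g'.left ≫ jo.left ≫ ι.left = f.left
    rw [← Over.comp_left, ← Over.comp_left, hg'']

end Literature.AlgebraicGeometry.Motives

end
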